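import Summits.QuantumFields.YangMills.Theses.SqueezedSkewness
import HarnessLib

/-!
# Route `SqueezedSkewness`, item `PointlikeMirrorFloorsGlue` (stmt-QuantumFields-27938) — glue of the DESCENT BRIDGE split

`theorem squeezedSkewness_pointlikeMirrorFloorsGlue : PointlikeMirrorFloorsGlue`, i.e.
`PointlikeZeroTemperatureFloors → HypercubePurity → ElectricSeam → PeriodDescent → HypercubeSeam → PointlikeMirrorFloors`
(split gen 1 of the residual crux stmt-QuantumFields-25918, route rev 5, commit 175227657669).  ThermalDescent's `closes`
argument run PER RADIUS ρ: cylinder floor ε for the bump v at (β, L, k₀) times hypercube purity π₀, minus the electric seam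
ε·π₀/2, through the period-descent / hypercube-seam identities ⇒ hypercube mirror floor ε·π₀/4 ≤ Q2(θv, v); time-positivity
of tsupport v from δ₁ > 0.

R3/RECORD framing: route glue only — the line's open obligations are `PointlikeZeroTemperatureFloors` (27936),
`HypercubePurity` (26514), `ElectricSeam` (25582), `PeriodDescent` (26517), `HypercubeSeam` (27937), `ShellGeometry` (27860)
and `ShellSign` (27861); NT and a fortiori the Yang–Mills mass gap are NOT proved here.
-/

set_option autoImplicit false

namespace Summit.QuantumFields.YangMills.Theorems

open Summit.QuantumFields.YangMills.Theses.SqueezedSkewness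

/-- The glue item of the descent-bridge split of `PointlikeMirrorFloors` (kernel-checked composition). -/
theorem squeezedSkewness_pointlikeMirrorFloorsGlue :
    Summit.QuantumFields.YangMills.Theses.SqueezedSkewness.PointlikeMirrorFloorsGlue := by
  intro hZ hP hE hD hH G _ _ _ _ hG
  letI : MeasurableSpace G := borel G
  haveI : BorelSpace G := ⟨rfl⟩
  obtain ⟨r, a, ha, ha0, hall⟩ := hZ G hG
  refine ⟨r, a, ha, ha0, fun ρ hρ => ?_⟩
  obtain ⟨v, hv0, hball, hpkg⟩ := hall ρ hρ
  obtain ⟨π₀, β₆, Λ₆, hπ₀, hpur⟩ := hP G hG r a ha ha0 ⟨v, hpkg⟩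
  obtain ⟨δ₁, δ₂, ε, β₅, Λ₅, hδ₁, hsupp, hε, hfloor⟩ := hpkg
  have hη : (0 : ℝ) < ε * π₀ / 2 := by positivity
  obtain ⟨β₉, Λ₉, hseam⟩ := hE G hG r a ha ha0 v δ₁ δ₂ hδ₁ hsupp ⟨ε, β₅, Λ₅, hε, hfloor⟩ (ε * π₀ / 2) hη
  obtain ⟨β₈, hβ₈⟩ : ∃ β₈ : ℝ, ∀ β, β₈ ≤ β → a β ≤ 1 := by
    have h1 : ∀ᶠ β in Filter.atTop, a β < 1 := ha0.eventually (gt_mem_nhds one_pos)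
    obtain ⟨β₈, hβ₈⟩ := Filter.eventually_atTop.mp h1
    exact ⟨β₈, fun β hβ => (hβ₈ β hβ).le⟩
  refine ⟨v, hv0, hball, ?_, ε * π₀ / 4, max (max β₅ β₆) (max β₈ (max β₉ 0)),
    max (max Λ₅ Λ₆) (max Λ₉ (|δ₂| + 1)), by positivity, ?_⟩
  · intro y hy
    have h := hsupp hy
    simp only [Set.mem_setOf_eq] at h ⊢
    linarith [h.1]
  · intro β hβ L hL
    simp only [max_le_iff] at hβ hL
    obtain ⟨⟨hβ5, hβ6⟩, hβ8, hβ9, hβ0⟩ := hβ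
    obtain ⟨⟨hL5, hL6⟩, hL9, hL8⟩ := hL
    obtain ⟨k₀, hk⟩ := hfloor β hβ5 L hL5
    have hfl := hk k₀ le_rfl
    have ha1 : a β ≤ 1 := hβ₈ β hβ8
    have hsz : δ₂ + a β ≤ a β * L := by
      have := le_abs_self δ₂
      linarith
    have hL1 : 1 ≤ L := by
      have hLnn : (0 : ℝ) ≤ (L : ℝ) := Nat.cast_nonneg L
      have hmul : a β * (L : ℝ) ≤ (L : ℝ) := mul_le_of_le_one_left hLnn ha1
      have h1 : (1 : ℝ) ≤ (L : ℝ) := by linarith [abs_nonneg δ₂]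
      exact_mod_cast h1
    have hdesc := hD G hG r β L k₀ (a β) v δ₁ δ₂ hβ0 hL1 (ha β) hδ₁ hsupp hsz (le_trans hε.le hfl)
    have hcube := hH G hG r β L (a β) v δ₁ δ₂ hβ0 hL1 (ha β) hδ₁ hsupp hsz
    have hP' := hpur β hβ6 L hL6
    have hE' := hseam β hβ9 L hL9
    have hprod := mul_le_mul hP' hfl hε.le (le_trans hπ₀.le hP')
    linarith

end Summit.QuantumFields.YangMills.Theorems
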